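/-
Copyright (c) 2026 the pub-hodgecm-mathlib formalisation cell (harness21).  Prover seat hodgecm-mathlib-LH4-p08 (g2), req620 Track A «(D-RAM) FOUR-FRAME» squad, unit U3_Laws (iii),
MS ROAD STAGE B (Stage B lead LH4-p10 (g2), MS ledger LH4-p11; dealer LH4-plan (g11)): B56-ASSEMBLY `stub_B56_G1` (skeleton `B10-StableCountTypeZero.SKELETON.v1` c61f53438acbd4dd :84),
FILE F3b «ON THE GLUE FOOT: the orbit decomposition and THE GLUE SUMMAND `q^{2ρ + t − ⌈(2ρ−m)∕2⌉}`».  2026-09-04.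
-/
import Summits.HodgeConjecture.HodgeConjecture.Theorems.F0P3cDyRamDiagonalGluedFootClasses          -- F3a (this seat): `mapGL_latt_glued_eq_iff_kappa`, `ncard_glue_representatives_eq`, `glue_representatives_eq_empty`
import Summits.HodgeConjecture.HodgeConjecture.Theorems.F0P3cDyRamDiagonalGluedTorusOrbits           -- ★ p855894 (iv-a) (this seat): orbit lemmas, dualisability criterion in `κ`
import Summits.HodgeConjecture.HodgeConjecture.Theorems.F0P3cDyRamDiagonalGluedStabiliserIndexFull  -- ★ p856033 (iv-b-idx) (this seat): `ncard_unitTorus_orbit_latt_glued_eq`; brings ★ B5 (iii) FILE 2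
import Summits.HodgeConjecture.HodgeConjecture.Theorems.F0P3cDyRamDiagonalGluedClassRepresentatives -- ★ p855991 (iv-c) (this seat): the representatives `R`
import Summits.HodgeConjecture.HodgeConjecture.Theorems.F0P3cDyRamDiagonalStratumTools               -- ★ (LH4-p13 (g2)): `finsum_mem_eq_ncard_mul`, `stabiliserWeight_mapGL_diagGLUnits`
import Mathlib.Data.Set.Card.Arithmetic
import HarnessLib

/-!
# Crux `H413`, MS ROAD STAGE B, B56-ASSEMBLY FILE F3b: THE GLUE SUMMAND of `stub_B56_G1` — on the glue foot (`n₁ = m + 2t`, `n₂ = n₃ = m`, `ρ ≤ m < 2ρ`) the glued stable dualisable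
# family is `⨆_{g ∈ R, |g + g₀| ≤ |ϖ|^{2ρ+2t−m}} 𝒯·latt V(1,1,g)` and `∑ w = q^{2ρ + t − ⌈(2ρ−m)∕2⌉}` — or `0` if the glue unit `g₀ = (β−1)∕(α−1)` is not `F`-rational to depth `2ρ + 2t − m`

Cell `hodgecm-mathlib` (D-0151), FLOOR 0, crux item H413 = `stmt-HodgeConjecture-24833`; lane `--supports stmt-HodgeConjecture-24833 --as helper` (count-neutral).  THEOREMS ONLY (no `def`,
no instance, no notation, no `sorry`, default heartbeats).  LH4-p10 (g2) MEMO v2 §4 (GG); the twin at `s = 0` is LH4-p07 (g3)'s B7 (iv) FILE (D).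
THE PROOF (orbit–stabiliser, as ★ B5 (iv)).  By ★ F3a stability on the foot is `|κ + g₀| ≤ |ϖ|^e`, `e = 2ρ + 2t − m`, a condition on `κ = y″∕(xζ)` modulo `𝔭^{ρ+2t}` (`e ≤ ρ + 2t`); by ★ (iv-a) a
dualisable glued lattice with invariant class `g ∈ R` lies in the orbit `𝒯·latt V(1,1,g)` whose members all have `κ = g`; so the family is the disjoint union of the orbits over
`R′ = {g ∈ R : |g + g₀| ≤ |ϖ|^e}`; each orbit has `((q−1)q^{ρ+2t−1})((q−1)q^{2ρ−1})` members (★ (iv-b-idx)) of weight `1∕(((q−1)q^{⌈(ρ+2t)∕2⌉−1})((q−1)q^{ρ−1}))` (★ B5 (iii), weight is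
`𝒯`-invariant ★ `stabiliserWeight_mapGL_diagGLUnits`), and `#R′ = q^{⌈(ρ+2t)∕2⌉ − ⌈e∕2⌉}` or `0` (★ F3a).  Product: `q^{2ρ + t − ⌈(2ρ−m)∕2⌉}`.
* §1 `finsum_stabiliserWeight_glued_foot_eq_ncard_mul` — `∑ w = #R′ · |orbit| · weight` for any representative system `R`.
* §2 HEADS **`finsum_stabiliserWeight_glued_foot_eq`** (an `f₀` exists: `= q^{2ρ + t − (2ρ−m+1)∕2}`) and **`finsum_stabiliserWeight_glued_foot_eq_zero`** (none: `= 0`).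
HONEST LABEL.  Count-neutral; nothing printed is asserted; the census laws stay PROVER TARGETS; `HC_CM` is proved only modulo the 7 printed citations (2 remaining named inputs: hLiu418 =
`stmt-HodgeConjecture-24832`, h413 = `stmt-HodgeConjecture-24833`) until rung 0 closes.

## References
* [Kottwitz1986BaseChangeUnits] R. Kottwitz, *Base change for unit elements of Hecke algebras*, Compositio Math. 60 (1986), §1 pp. 240–241 (fixed-lattice counts via torus orbits and stabilisers).
* [Rogawski1990] J. D. Rogawski, *Automorphic Representations of Unitary Groups in Three Variables*, Ann. of Math. Stud. 123 (1990), §4.9 Prop. 4.9.1 (a) p. 55.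
-/

set_option autoImplicit false

noncomputable section

namespace Summit.HodgeConjecture.HodgeConjecture.Cruxes.H413.F0P3cDyRamDiagonalGluedFootContribution

open Matrix WithZero
open Literature.NumberTheory.Automorphic Literature.NumberTheory.Automorphic.HermitianLattice
open Literature.NumberTheory.Automorphic.UnitaryLatticeTree
open Summit.HodgeConjecture.HodgeConjecture.Cruxes.H413.F0P3cDyRamDiagonalTorusDefs
open Summit.HodgeConjecture.HodgeConjecture.Cruxes.H413.F0P3cDyRamDiagonalGluedTorusOrbits
open Summit.HodgeConjecture.HodgeConjecture.Cruxes.H413.F0P3cDyRamDiagonalGluedStabiliserIndex (stabiliserWeight_latt_glued_tube_eq index_product_eq_sq_mul_pow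
  ne_zero_and_v_lt_one_of_v_eq_exp)
open Summit.HodgeConjecture.HodgeConjecture.Cruxes.H413.F0P3cDyRamDiagonalGluedStabiliserIndexFull (ncard_unitTorus_orbit_latt_glued_eq)
open Summit.HodgeConjecture.HodgeConjecture.Cruxes.H413.F0P3cDyRamDiagonalGluedFootClasses
open Summit.HodgeConjecture.HodgeConjecture.Cruxes.H413.F0P3cDyRamDiagonalStratumTools (finsum_mem_eq_ncard_mul stabiliserWeight_mapGL_diagGLUnits)
open scoped Valued WithZero Matrix MatrixGroups

variable {K : Type*} [Field K] [Valued K ℤᵐ⁰]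

/-! ## §1 The sum over the foot family, for any representative system -/

/-- **THE FOOT FAMILY IS A DISJOINT UNION OF UNIT-TORUS ORBITS OVER THE GLUE CLASSES**, so its weighted count is `#R′ · |𝒯-orbit| · weight`: for `T = diag(α, β, 1)` on the glue foot
(`|β−1| = |ϖ|^{m+2t}`, `|α−1| = |β−α| = |ϖ|^m`, `ρ ≤ m < 2ρ`, `ρ, t ≥ 1`, trace bound), any irredundant complete system `R` of the fixed elements of valuation `|ϖ|^{2t}` mod `𝔭^{ρ+2t}`:
`∑ᶠ_{M glued, T-stable, dualisable} w(M) = #{g ∈ R : |g + (β−1)∕(α−1)| ≤ |ϖ|^{2ρ+2t−m}} · ((q−1)q^{ρ+2t−1})((q−1)q^{2ρ−1}) · (((q−1)q^{⌈(ρ+2t)∕2⌉−1})((q−1)q^{ρ−1}))⁻¹`.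
[cite: Kottwitz1986BaseChangeUnits, §1 pp. 240–241] [cite: Rogawski1990, §4.9 Prop. 4.9.1 (a) p. 55] -/
theorem finsum_stabiliserWeight_glued_foot_eq_ncard_mul {σ : K →+* K} (hσ : ∀ a, σ (σ a) = a) (hvσ : ∀ a, Valued.v (σ a) = Valued.v a)
    (hfix : ∀ x : K, σ x = x → x ≠ 0 → ∃ n : ℤ, Valued.v x = exp (2 * n)) {ϖ : K} (hϖ : Valued.v ϖ = exp (-1 : ℤ))
    {d : ℕ} (hd : Valued.v (ϖ - σ ϖ) = Valued.v ϖ ^ d) [Finite 𝓀[K]] (hTr : ∀ a : K, Valued.v (a + σ a) ≤ Valued.v ϖ * Valued.v a)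
    {α β : K} (hα : Valued.v α = 1) (hβ : Valued.v β = 1) (T : GL (Fin 3) K) (hT : (T : Matrix (Fin 3) (Fin 3) K) = Matrix.diagonal ![α, β, 1])
    (ρ t m : ℕ) (hρ : 1 ≤ ρ) (ht : 1 ≤ t) (h₁ : Valued.v (β - 1) = Valued.v ϖ ^ (m + 2 * t)) (h₂ : Valued.v (α - 1) = Valued.v ϖ ^ m)
    (h₃ : Valued.v (β - α) = Valued.v ϖ ^ m) (hρm : ρ ≤ m) (hm : m < 2 * ρ) {R : Set K} (hRfin : R.Finite)
    (hR1 : ∀ g ∈ R, σ g = g ∧ Valued.v g = Valued.v ϖ ^ (2 * t))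
    (hR2 : ∀ f : K, σ f = f → Valued.v f = Valued.v ϖ ^ (2 * t) → ∃ g ∈ R, Valued.v (f - g) ≤ Valued.v ϖ ^ (ρ + 2 * t))
    (hR3 : ∀ g ∈ R, ∀ g' ∈ R, Valued.v (g - g') ≤ Valued.v ϖ ^ (ρ + 2 * t) → g = g') :
    ∑ᶠ M ∈ {M : Submodule 𝒪[K] (Fin 3 → K) | ∃ x ζ y'' : K, Valued.v x = 1 ∧ Valued.v ζ = 1 ∧ Valued.v y'' = Valued.v ϖ ^ (2 * t) ∧
        M = latt (!![1, 0, 0; x, ϖ ^ ρ, 0; x * ζ + y'', ϖ ^ ρ * ζ, ϖ ^ (2 * ρ + 2 * t)] : Matrix (Fin 3) (Fin 3) K) ∧ mapGL T M = M ∧ IsDualisableLattice σ ϖ M},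
        stabiliserWeight σ M =
      ({g ∈ R | Valued.v (g + (β - 1) / (α - 1)) ≤ Valued.v ϖ ^ (2 * ρ + 2 * t - m)}.ncard : ℚ) *
        ((((Nat.card 𝓀[K] - 1) * Nat.card 𝓀[K] ^ (ρ + 2 * t - 1)) * ((Nat.card 𝓀[K] - 1) * Nat.card 𝓀[K] ^ (2 * ρ - 1)) : ℕ) : ℚ) *
        ((((Nat.card 𝓀[K] - 1) * Nat.card 𝓀[K] ^ ((ρ + 2 * t + 1) / 2 - 1)) * ((Nat.card 𝓀[K] - 1) * Nat.card 𝓀[K] ^ (ρ - 1)) : ℕ) : ℚ)⁻¹ := by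
  classical
  obtain ⟨hϖ0, hϖ1⟩ := ne_zero_and_v_lt_one_of_v_eq_exp hϖ
  have hpρ : ϖ ^ ρ ≠ 0 := pow_ne_zero ρ hϖ0
  have hpr : ϖ ^ (2 * ρ + 2 * t) ≠ 0 := pow_ne_zero _ hϖ0
  have hm' : m ≤ 2 * ρ + 2 * t := by omega
  -- reference lattices `V₀(g) = V(1, 1, g)` and their orbits
  choose V₀ hV₀ using fun g : K => exists_gl_coe_eq_glued (1 : K) 1 g hpρ hpr
  set Orb : K → Set (Submodule 𝒪[K] (Fin 3 → K)) := fun g => {M | ∃ u ∈ unitTorus K 3, M = mapGL (diagGLUnits u) (latt (V₀ g : Matrix (Fin 3) (Fin 3) K))}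
    with hOrb
  set R' : Set K := {g ∈ R | Valued.v (g + (β - 1) / (α - 1)) ≤ Valued.v ϖ ^ (2 * ρ + 2 * t - m)} with hR'
  have hvg : ∀ g ∈ R, Valued.v g < 1 := fun g hg => by
    rw [(hR1 g hg).2]; exact pow_lt_one₀ zero_le hϖ1 (by omega)
  have hlt : Valued.v ϖ ^ (ρ + 2 * t) < Valued.v ϖ ^ (2 * t) := by
    rw [pow_add, mul_comm]
    exact mul_lt_of_lt_one_right (pow_pos ((Valuation.pos_iff _).2 hϖ0) _) (pow_lt_one₀ zero_le hϖ1 (by omega))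
  have hen : Valued.v ϖ ^ (ρ + 2 * t) ≤ Valued.v ϖ ^ (2 * ρ + 2 * t - m) := (v_pow_le_v_pow_iff hϖ _ _).2 (by omega)
  have h11 : Valued.v (1 : K) = 1 := map_one _
  -- §1a: the set identity
  have hset : {M : Submodule 𝒪[K] (Fin 3 → K) | ∃ x ζ y'' : K, Valued.v x = 1 ∧ Valued.v ζ = 1 ∧ Valued.v y'' = Valued.v ϖ ^ (2 * t) ∧
        M = latt (!![1, 0, 0; x, ϖ ^ ρ, 0; x * ζ + y'', ϖ ^ ρ * ζ, ϖ ^ (2 * ρ + 2 * t)] : Matrix (Fin 3) (Fin 3) K) ∧ mapGL T M = M ∧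
        IsDualisableLattice σ ϖ M} = ⋃ g ∈ R', Orb g := by
    ext M
    simp only [Set.mem_setOf_eq, Set.mem_iUnion, hOrb, hR', exists_prop]
    constructor
    · rintro ⟨x, ζ, y'', hx, hζ, hy'', rfl, hstab, hdual⟩
      obtain ⟨V, hV⟩ := exists_gl_coe_eq_glued x ζ y'' hpρ hpr
      rw [← hV] at hdual hstab
      have hκ := (mapGL_latt_glued_eq_iff_kappa hϖ hα hβ T hT h₁ h₂ h₃ hρm hm' hx hζ V hV).1 hstab
      obtain ⟨f, hσf, hκf⟩ := (isDualisableLattice_latt_glued_iff_exists_fixed_kappa hσ hvσ hϖ0 hϖ1 hTr ρ t hρ ht hx hζ hy'' V hV).1 hdual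
      have hvκ : Valued.v (y'' / (x * ζ)) = Valued.v ϖ ^ (2 * t) := by rw [map_div₀, map_mul, hx, hζ, mul_one, div_one, hy'']
      have hvf : Valued.v f = Valued.v ϖ ^ (2 * t) := by
        have h := Valuation.map_sub_eq_of_lt_left Valued.v (hvκ ▸ hκf.trans_lt hlt : Valued.v (y'' / (x * ζ) - f) < Valued.v (y'' / (x * ζ)))
        rw [← hvκ, ← h, sub_sub_cancel]
      obtain ⟨g, hg, hfg⟩ := hR2 f hσf hvf
      have hκg : Valued.v (y'' / (x * ζ) - g) ≤ Valued.v ϖ ^ (ρ + 2 * t) := by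
        rw [show y'' / (x * ζ) - g = (y'' / (x * ζ) - f) + (f - g) by ring]
        exact Valuation.map_add_le _ hκf hfg
      obtain ⟨u, hu, hM⟩ := exists_mem_unitTorus_latt_glued_eq_mapGL hϖ0 ρ t hx hζ hy'' ht hϖ1 (hvg g hg) hκg (V₀ g) (hV₀ g)
      refine ⟨g, ⟨hg, ?_⟩, u, hu, hM⟩
      rw [show g + (β - 1) / (α - 1) = (y'' / (x * ζ) + (β - 1) / (α - 1)) - (y'' / (x * ζ) - g) by ring]
      exact Valuation.map_sub_le _ hκ (hκg.trans hen)
    · rintro ⟨g, ⟨hg, hge⟩, u, hu, rfl⟩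
      obtain ⟨x', ζ', y₁, hx', hζ', hy₁, hκ, hM⟩ := exists_glued_of_mem_orbit u hu g (ϖ ^ ρ) (ϖ ^ (2 * ρ + 2 * t)) (V₀ g) (hV₀ g)
      have hy₁' : Valued.v y₁ = Valued.v ϖ ^ (2 * t) := by rw [hy₁, (hR1 g hg).2]
      obtain ⟨V, hV⟩ := exists_gl_coe_eq_glued x' ζ' y₁ hpρ hpr
      refine ⟨x', ζ', y₁, hx', hζ', hy₁', hM, ?_, ?_⟩
      · rw [hM, ← hV]
        exact (mapGL_latt_glued_eq_iff_kappa hϖ hα hβ T hT h₁ h₂ h₃ hρm hm' hx' hζ' V hV).2 (by rw [hκ]; exact hge)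
      · rw [hM, ← hV]
        exact (isDualisableLattice_latt_glued_iff_exists_fixed_kappa hσ hvσ hϖ0 hϖ1 hTr ρ t hρ ht hx' hζ' hy₁' V hV).2
          ⟨g, (hR1 g hg).1, by rw [hκ, sub_self, map_zero]; exact zero_le⟩
  -- §1b: pairwise disjoint
  have hdisj : R'.PairwiseDisjoint Orb := by
    intro g hg g' hg' hne
    rw [Function.onFun, Set.disjoint_left]
    intro M hM hM'
    apply hne
    simp only [hOrb, Set.mem_setOf_eq] at hM hM'
    obtain ⟨u, hu, rfl⟩ := hM
    obtain ⟨u', hu', hMM⟩ := hM'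
    obtain ⟨x, ζ, y, hx, hζ, hy, hκ, h1⟩ := exists_glued_of_mem_orbit u hu g (ϖ ^ ρ) (ϖ ^ (2 * ρ + 2 * t)) (V₀ g) (hV₀ g)
    obtain ⟨x', ζ', y', hx', hζ', -, hκ', h2⟩ := exists_glued_of_mem_orbit u' hu' g' (ϖ ^ ρ) (ϖ ^ (2 * ρ + 2 * t)) (V₀ g') (hV₀ g')
    have hyv : Valued.v y = Valued.v ϖ ^ (2 * t) := by rw [hy, (hR1 g hg.1).2]
    have hv := v_kappa_sub_le_of_latt_glued_eq hϖ0 hϖ1.le ρ t hx hζ hyv hx' hζ' (h1.symm.trans (hMM.trans h2))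
    rw [hκ, hκ'] at hv
    exact hR3 g hg.1 g' hg'.1 hv
  -- §1c: orbit sizes and the (constant) weight
  have hN : ∀ g ∈ R', (Orb g).ncard = ((Nat.card 𝓀[K] - 1) * Nat.card 𝓀[K] ^ (ρ + 2 * t - 1)) * ((Nat.card 𝓀[K] - 1) * Nat.card 𝓀[K] ^ (2 * ρ - 1)) :=
    fun g hg => ncard_unitTorus_orbit_latt_glued_eq hϖ hρ (2 * t) h11 h11 (by rw [(hR1 g hg.1).2]) (V₀ g) (by rw [hV₀ g])
  have hq : 1 < Nat.card 𝓀[K] := Finite.one_lt_card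
  have hN0 : ((Nat.card 𝓀[K] - 1) * Nat.card 𝓀[K] ^ (ρ + 2 * t - 1)) * ((Nat.card 𝓀[K] - 1) * Nat.card 𝓀[K] ^ (2 * ρ - 1)) ≠ 0 :=
    mul_ne_zero (mul_ne_zero (by omega) (pow_ne_zero _ (by omega))) (mul_ne_zero (by omega) (pow_ne_zero _ (by omega)))
  have hfinOrb : ∀ g ∈ R', (Orb g).Finite := fun g hg => Set.finite_of_ncard_ne_zero (by rw [hN g hg]; exact hN0)
  have hw : ∀ g ∈ R', ∀ M ∈ Orb g, stabiliserWeight σ M =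
      ((((Nat.card 𝓀[K] - 1) * Nat.card 𝓀[K] ^ ((ρ + 2 * t + 1) / 2 - 1)) * ((Nat.card 𝓀[K] - 1) * Nat.card 𝓀[K] ^ (ρ - 1)) : ℕ) : ℚ)⁻¹ := by
    rintro g hg M ⟨u, -, rfl⟩
    rw [stabiliserWeight_mapGL_diagGLUnits]
    exact stabiliserWeight_latt_glued_tube_eq hσ hvσ hfix hϖ hd hρ t h11 h11 (hR1 g hg.1).2 (V₀ g) (hV₀ g) (hR1 g hg.1).1
      (by rw [map_one, (hR1 g hg.1).1, one_mul, sub_self, map_zero]; exact zero_le)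
  have hR'fin : R'.Finite := hRfin.subset (Set.sep_subset _ _)
  rw [hset, finsum_mem_biUnion hdisj hR'fin hfinOrb,
    finsum_mem_congr rfl (fun g hg => finsum_mem_eq_ncard_mul (hfinOrb g hg) _ _ (hw g hg)),
    finsum_mem_congr rfl (fun g hg => by rw [hN g hg]), finsum_mem_eq_ncard_mul hR'fin _ _ (fun g _ => rfl)]
  ring

/-! ## §2 HEADS — the glue summand -/

/-- **THE GLUE SUMMAND of `stub_B56_G1`**: on the glue foot (`|β−1| = |ϖ|^{m+2t}`, `|α−1| = |β−α| = |ϖ|^m`, `ρ ≤ m < 2ρ`, `ρ, t ≥ 1`, trace bound, finite residue field), IF some fixed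
`f₀` has `|f₀ + (β−1)∕(α−1)| ≤ |ϖ|^{2ρ+2t−m}` (the glue unit is `F`-rational to depth `2ρ + 2t − m`, i.e. `2ρ − m ≤ m − d + 1` by the ★ bridge), then
`∑ᶠ_{M glued, T-stable, dualisable} 1∕[𝒰 : S_F(M)] = q^{2ρ + t − ⌈(2ρ−m)∕2⌉}`. [cite: Kottwitz1986BaseChangeUnits, §1 pp. 240–241] [cite: Rogawski1990, §4.9 Prop. 4.9.1 (a) p. 55] -/
theorem finsum_stabiliserWeight_glued_foot_eq {σ : K →+* K} (hσ : ∀ a, σ (σ a) = a) (hvσ : ∀ a, Valued.v (σ a) = Valued.v a)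
    (hfix : ∀ x : K, σ x = x → x ≠ 0 → ∃ n : ℤ, Valued.v x = exp (2 * n)) {ϖ : K} (hϖ : Valued.v ϖ = exp (-1 : ℤ))
    {d : ℕ} (hd : Valued.v (ϖ - σ ϖ) = Valued.v ϖ ^ d) [Finite 𝓀[K]] (hTr : ∀ a : K, Valued.v (a + σ a) ≤ Valued.v ϖ * Valued.v a)
    {α β : K} (hα : Valued.v α = 1) (hβ : Valued.v β = 1) (T : GL (Fin 3) K) (hT : (T : Matrix (Fin 3) (Fin 3) K) = Matrix.diagonal ![α, β, 1])
    (ρ t m : ℕ) (hρ : 1 ≤ ρ) (ht : 1 ≤ t) (h₁ : Valued.v (β - 1) = Valued.v ϖ ^ (m + 2 * t)) (h₂ : Valued.v (α - 1) = Valued.v ϖ ^ m)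
    (h₃ : Valued.v (β - α) = Valued.v ϖ ^ m) (hρm : ρ ≤ m) (hm : m < 2 * ρ)
    {f₀ : K} (hσf₀ : σ f₀ = f₀) (hf₀ : Valued.v (f₀ + (β - 1) / (α - 1)) ≤ Valued.v ϖ ^ (2 * ρ + 2 * t - m)) :
    ∑ᶠ M ∈ {M : Submodule 𝒪[K] (Fin 3 → K) | ∃ x ζ y'' : K, Valued.v x = 1 ∧ Valued.v ζ = 1 ∧ Valued.v y'' = Valued.v ϖ ^ (2 * t) ∧
        M = latt (!![1, 0, 0; x, ϖ ^ ρ, 0; x * ζ + y'', ϖ ^ ρ * ζ, ϖ ^ (2 * ρ + 2 * t)] : Matrix (Fin 3) (Fin 3) K) ∧ mapGL T M = M ∧ IsDualisableLattice σ ϖ M},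
        stabiliserWeight σ M = (Nat.card 𝓀[K] : ℚ) ^ (2 * ρ + t - (2 * ρ - m + 1) / 2) := by
  obtain ⟨R, hRfin, -, hR1, hR2, hR3⟩ := F0P3cDyRamDiagonalGluedClassRepresentatives.exists_fixed_class_representatives hσ hvσ hfix hϖ hd ρ t hρ
  have hvϖ0 : Valued.v ϖ ≠ 0 := by rw [hϖ]; exact exp_ne_zero
  have hg₀ : Valued.v ((β - 1) / (α - 1)) = Valued.v ϖ ^ (2 * t) := by
    rw [map_div₀, h₁, h₂, pow_add, mul_div_cancel_left₀ _ (pow_ne_zero m hvϖ0)]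
  rw [finsum_stabiliserWeight_glued_foot_eq_ncard_mul hσ hvσ hfix hϖ hd hTr hα hβ T hT ρ t m hρ ht h₁ h₂ h₃ hρm hm hRfin hR1 hR2 hR3,
    ncard_glue_representatives_eq hσ hvσ hfix hϖ hd (by omega) (by omega) hRfin hR1 hR2 hR3 hg₀ hσf₀ hf₀,
    index_product_eq_sq_mul_pow (Nat.card 𝓀[K]) hρ (2 * t)]
  have hq : 1 < Nat.card 𝓀[K] := Finite.one_lt_card
  have hq1 : ((Nat.card 𝓀[K] : ℚ) - 1) ≠ 0 := sub_ne_zero.2 (by exact_mod_cast hq.ne')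
  have hq0 : (Nat.card 𝓀[K] : ℚ) ≠ 0 := by exact_mod_cast (by omega : Nat.card 𝓀[K] ≠ 0)
  have hc0 : ((((Nat.card 𝓀[K] - 1) ^ 2 * Nat.card 𝓀[K] ^ ((ρ + 2 * t + 1) / 2 + ρ - 2)) : ℕ) : ℚ) ≠ 0 := by
    push_cast [Nat.cast_sub hq.le]; exact mul_ne_zero (pow_ne_zero _ hq1) (pow_ne_zero _ hq0)
  have hexp : ((ρ + 2 * t + 1) / 2 - (2 * ρ + 2 * t - m + 1) / 2) + ((ρ + 2 * t - 1) + (2 * ρ - 1)) =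
      (2 * ρ + t - (2 * ρ - m + 1) / 2) + ((ρ + 2 * t + 1) / 2 + ρ - 2) := by omega
  have key : (Nat.card 𝓀[K] : ℚ) ^ ((ρ + 2 * t + 1) / 2 - (2 * ρ + 2 * t - m + 1) / 2) * ((Nat.card 𝓀[K] : ℚ) ^ (ρ + 2 * t - 1) * (Nat.card 𝓀[K] : ℚ) ^ (2 * ρ - 1)) =
      (Nat.card 𝓀[K] : ℚ) ^ (2 * ρ + t - (2 * ρ - m + 1) / 2) * (Nat.card 𝓀[K] : ℚ) ^ ((ρ + 2 * t + 1) / 2 + ρ - 2) := by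
    rw [← pow_add, ← pow_add, ← pow_add, hexp]
  rw [mul_inv_eq_iff_eq_mul₀ hc0]
  push_cast [Nat.cast_sub hq.le]
  linear_combination ((Nat.card 𝓀[K] : ℚ) - 1) ^ 2 * key

/-- **NO GLUE BEYOND THE F-RATIONALITY DEPTH OF THE GLUE UNIT**: on the same foot, if NO fixed `f` has `|f + (β−1)∕(α−1)| ≤ |ϖ|^{2ρ+2t−m}`, the glued stable dualisable family is empty and
the sum is `0`. [cite: Kottwitz1986BaseChangeUnits, §1 pp. 240–241] -/
theorem finsum_stabiliserWeight_glued_foot_eq_zero {σ : K →+* K} (hσ : ∀ a, σ (σ a) = a) (hvσ : ∀ a, Valued.v (σ a) = Valued.v a)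
    (hfix : ∀ x : K, σ x = x → x ≠ 0 → ∃ n : ℤ, Valued.v x = exp (2 * n)) {ϖ : K} (hϖ : Valued.v ϖ = exp (-1 : ℤ))
    {d : ℕ} (hd : Valued.v (ϖ - σ ϖ) = Valued.v ϖ ^ d) [Finite 𝓀[K]] (hTr : ∀ a : K, Valued.v (a + σ a) ≤ Valued.v ϖ * Valued.v a)
    {α β : K} (hα : Valued.v α = 1) (hβ : Valued.v β = 1) (T : GL (Fin 3) K) (hT : (T : Matrix (Fin 3) (Fin 3) K) = Matrix.diagonal ![α, β, 1])
    (ρ t m : ℕ) (hρ : 1 ≤ ρ) (ht : 1 ≤ t) (h₁ : Valued.v (β - 1) = Valued.v ϖ ^ (m + 2 * t)) (h₂ : Valued.v (α - 1) = Valued.v ϖ ^ m)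
    (h₃ : Valued.v (β - α) = Valued.v ϖ ^ m) (hρm : ρ ≤ m) (hm : m < 2 * ρ)
    (hno : ¬ ∃ f : K, σ f = f ∧ Valued.v (f + (β - 1) / (α - 1)) ≤ Valued.v ϖ ^ (2 * ρ + 2 * t - m)) :
    ∑ᶠ M ∈ {M : Submodule 𝒪[K] (Fin 3 → K) | ∃ x ζ y'' : K, Valued.v x = 1 ∧ Valued.v ζ = 1 ∧ Valued.v y'' = Valued.v ϖ ^ (2 * t) ∧
        M = latt (!![1, 0, 0; x, ϖ ^ ρ, 0; x * ζ + y'', ϖ ^ ρ * ζ, ϖ ^ (2 * ρ + 2 * t)] : Matrix (Fin 3) (Fin 3) K) ∧ mapGL T M = M ∧ IsDualisableLattice σ ϖ M},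
        stabiliserWeight σ M = 0 := by
  obtain ⟨R, hRfin, -, hR1, hR2, hR3⟩ := F0P3cDyRamDiagonalGluedClassRepresentatives.exists_fixed_class_representatives hσ hvσ hfix hϖ hd ρ t hρ
  rw [finsum_stabiliserWeight_glued_foot_eq_ncard_mul hσ hvσ hfix hϖ hd hTr hα hβ T hT ρ t m hρ ht h₁ h₂ h₃ hρm hm hRfin hR1 hR2 hR3,
    glue_representatives_eq_empty hR1 hno, Set.ncard_empty, Nat.cast_zero, zero_mul, zero_mul]

end Summit.HodgeConjecture.HodgeConjecture.Cruxes.H413.F0P3cDyRamDiagonalGluedFootContribution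

end
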